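import Summits.HubbardSuperconductivity.HubbardSuperconductivity.Theorems.AnisotropyChordTransferFibre3N1RowObjJFull
import Summits.HubbardSuperconductivity.HubbardSuperconductivity.Theorems.AnisotropyChordTransferFibre3N1RowObjQ
import Summits.HubbardSuperconductivity.HubbardSuperconductivity.Theorems.AnisotropyChordTransferFibre3BCOuter

/-!
# Route `AnisotropyChord` / H0 rotor rung, LEVEL 2 row `N₁`: the PAIR KERNEL of `Ĵ₁` at the true vector

Soundness of the block layer of part 4b (`…N1RowExprJ`) for a ground profile, `X = xTrue L Δ λ₂ f a`, `t = θ²`, a pair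
`(k, k′) = (toTor q, toTor q + x̂)` and a direction `e ∈ E4`:
* ★ `eval_r12`: `r12 ↦ t·Re(μ_e(k)^* μ_e(k′))` (`OuterMaj.re_conj_muK_mul`, `re_phase_mul_conj_shift`, the `w`-dictionary);
* ★ `cross_bounds`: `t·Re(φ̂_e(k)^*φ̂_e(k′)) ∈ [r12 − dev12, r12 + dev12]` (`BlockCrossTerm` + `PhiHatNearClosed`, `√m2 = √t‖μ‖`,
  `p1 = √t·P`);
* ★ `pair_bounds`: `pairLo.eval X ≤ t²·Σ_e bcSummand(e, k) ≤ pairHi.eval X` on the pair block;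
* ★ `eval_gam1` (`gam1 ↦ γ`), `eval_r0`/`dev0_bound` and ★ `pair0_bounds`, `pairM_bounds`: the two special pairs `(0, x̂)`, `(−x̂, 0)`
  (`φ̂_e(0) = γ`).
Prover seat `hubbard-h0-rotor-p2` g5; helper for piece A = stmt-HubbardSuperconductivity-23918 of rung 19089
(`--supports`, helper class).  Nothing here proves superconductivity in the Hubbard model; helper lemmas of ONE conditional
reduction (the GM₃ ∀L certificate, Level-2 row `N₁`); the rotor TARGET as originally worded stays FALSE (g15 verdict).
Mathlib + the tree only; no sorry.
-/

set_option linter.dupNamespace false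
set_option autoImplicit false

open Literature.Analysis.ValidatedNumerics

namespace Summit.HubbardSuperconductivity.HubbardSuperconductivity.Theorems.AnisotropyChord.Transfer.Fibre3.L2.N1

variable (L : ℕ) [NeZero L] (Δ lam2 : ℝ) (f : Tor L → ℝ)

/-! ## The closed cross term -/

/-- grid facts: `(1,0)`, `(−1,0)` are grid points; `qdot (1,0) e = e.1`; `shx q = (q.1 + 1, q.2)`. -/
theorem qdot_one_zero (e : ℤ × ℤ) : qdot (1, 0) e = e.1 := by simp [qdot]

/-- ★ `r12 ↦ t·Re(conj μ_e(k) · μ_e(k′))` at a grid pair. -/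
theorem eval_r12 (hL : 5 ≤ L) (hΔ0 : 0 ≤ Δ) (hΔ1 : Δ < 1) (hf : IsGroundTwoMagnon L Δ lam2 f) (hlam : 0 < lam2)
    {q e : ℤ × ℤ} (hq : q ∈ gridPts 3) (hq' : (q.1 + 1, q.2) ∈ gridPts 3) (he : e ∈ E4) :
    (r12 3 q e).eval (xTrue L Δ lam2 f (Δ * f (K1 L)))
      = (2 * Real.pi / L) ^ 2 * ((starRingEnd ℂ) (muK L Δ lam2 f (B1.toTor L e) (B1.toTor L q))
          * muK L Δ lam2 f (B1.toTor L e) (B1.toTor L q + K1 L)).re := by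
  set X := xTrue L Δ lam2 f (Δ * f (K1 L)) with hXdef
  set t : ℝ := (2 * Real.pi / L) ^ 2 with ht
  obtain ⟨_, _, hb⟩ := eval_closed L Δ lam2 f hL hΔ0 hΔ1 hf hlam hq
  obtain ⟨_, _, hb'⟩ := eval_closed L Δ lam2 f hL hΔ0 hΔ1 hf hlam hq'
  rw [toTor_shift] at hb'
  have hqq := eval_qq L Δ lam2 f hL hΔ0 hΔ1 hf
  have hX0 : X 0 = t := xTrue_zero L Δ lam2 f _
  have hwn := one_sub_phase_re L Δ lam2 f (Δ * f (K1 L)) hq he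
  have hwn' := one_sub_phase_re L Δ lam2 f (Δ * f (K1 L)) hq' he
  rw [toTor_shift] at hwn'
  have hwd := one_sub_phase_re L Δ lam2 f (Δ * f (K1 L)) axis_mem_gridPts_three.1 he
  rw [ClosedExp.toTor_one_zero, qdot_one_zero] at hwd
  rw [OuterMaj.re_conj_muK_mul, OuterMaj.re_phase_mul_conj_shift]
  have e1 : (r12 3 q e).eval X = ((wOf 3 (qdot q e)).eval X + (wOf 3 (qdot (shx q) e)).eval X - (wOf 3 e.1).eval X)
        * ((bh 3 q).eval X * (bh 3 (shx q)).eval X)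
      - 1 / 2 * qq.eval X * X 0 * (bh 3 q).eval X * ((wOf 3 (qdot q e)).eval X - (wOf 3 (qdot (shx q) e)).eval X + (wOf 3 e.1).eval X)
      - 1 / 2 * qq.eval X * X 0 * (bh 3 (shx q)).eval X
          * ((wOf 3 (qdot (shx q) e)).eval X - (wOf 3 (qdot q e)).eval X + (wOf 3 e.1).eval X)
      + 1 / 4 * qq.eval X ^ 2 * X 0
          * (4 - X 0 * ((wOf 3 (qdot q e)).eval X + (wOf 3 (qdot (shx q) e)).eval X + (wOf 3 e.1).eval X)) := by
    simp only [r12, rsum, RExpr.eval, cst, vT]; push_cast; ring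
  have hshx : shx q = (q.1 + 1, q.2) := rfl
  rw [e1, hshx, hb, hb', hqq, hX0]
  set wn := (wOf 3 (qdot q e)).eval X
  set wn' := (wOf 3 (qdot (q.1 + 1, q.2) e)).eval X
  set wd := (wOf 3 e.1).eval X
  have h1 : (phase L (B1.toTor L q) (B1.toTor L e)).re = 1 - t * wn := by rw [← hwn]; ring
  have h2 : (phase L (B1.toTor L q + K1 L) (B1.toTor L e)).re = 1 - t * wn' := by rw [← hwn']; ring
  have h3 : (phase L (K1 L) (B1.toTor L e)).re = 1 - t * wd := by rw [← hwd]; ring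
  rw [h1, h2, h3]
  ring

/-- ★ the cross term is within `dev12` of `r12`: `t·Re(conj φ̂_e(k) φ̂_e(k′)) ∈ [r12 − dev12, r12 + dev12]` (`L ≥ 7`). -/
theorem cross_bounds (hL : 7 ≤ L) (hΔ0 : 0 ≤ Δ) (hΔ1 : Δ < 1) (hf : IsGroundTwoMagnon L Δ lam2 f) (hlam : 0 < lam2)
    {q e : ℤ × ℤ} (hq : q ∈ gridPts 3) (hq' : (q.1 + 1, q.2) ∈ gridPts 3) (he : e ∈ E4) :
    let X := xTrue L Δ lam2 f (Δ * f (K1 L))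
    let x := (2 * Real.pi / L) ^ 2 * ((starRingEnd ℂ) (phiHat L f (B1.toTor L e) (B1.toTor L q))
          * phiHat L f (B1.toTor L e) (B1.toTor L q + K1 L)).re
    (r12 3 q e).eval X - (dev12 3 q e).eval X ≤ x ∧ x ≤ (r12 3 q e).eval X + (dev12 3 q e).eval X := by
  intro X x
  set θ : ℝ := 2 * Real.pi / L with hθ
  set k := B1.toTor L q with hk
  set e' := B1.toTor L e with he'
  have hLpos : (0 : ℝ) < L := by exact_mod_cast (show 0 < L by omega)
  have hθpos : 0 < θ := by positivity
  have hk0 : k ≠ 0 := by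
    show B1.toTor L q ≠ 0
    have := B1.intCast_ne_zero_of_mem_zWindow L 3 (by omega) q (gridPts_three_window q hq)
    simpa [B1.toTor] using this
  have hk1 : k + K1 L ≠ 0 := by
    show B1.toTor L q + K1 L ≠ 0
    rw [← toTor_shift]
    have := B1.intCast_ne_zero_of_mem_zWindow L 3 (by omega) _ (gridPts_three_window _ hq')
    simpa [B1.toTor] using this
  -- the two radii
  set P1 : ℝ := ‖(1 : ℂ) - zPh L k e'‖ / 2 * |tfun L Δ f k| + tauBar L Δ lam2 f / 2 with hP1
  set P2 : ℝ := ‖(1 : ℂ) - zPh L (k + K1 L) e'‖ / 2 * |tfun L Δ f (k + K1 L)| + tauBar L Δ lam2 f / 2 with hP2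
  have hn1 : ‖phiHat L f e' k - muK L Δ lam2 f e' k‖ ≤ P1 :=
    OuterMaj.phiHatNearClosed_holds L (by omega) hΔ0 lam2 f hf hlam e' (toTor_mem_nnList L he) k hk0
  have hn2 : ‖phiHat L f e' (k + K1 L) - muK L Δ lam2 f e' (k + K1 L)‖ ≤ P2 :=
    OuterMaj.phiHatNearClosed_holds L (by omega) hΔ0 lam2 f hf hlam e' (toTor_mem_nnList L he) (k + K1 L) hk1
  have hbct := (OuterMaj.blockCrossTerm_holds (phiHat L f e' k) (phiHat L f e' (k + K1 L)) (muK L Δ lam2 f e' k)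
    (muK L Δ lam2 f e' (k + K1 L)) P1 P2 hn1 hn2).1
  -- the hatted radii
  have hm1 : Real.sqrt ((m2 3 q e).eval X) = θ * ‖muK L Δ lam2 f e' k‖ := by
    rw [eval_m2 L Δ lam2 f (by omega) hΔ0 hΔ1 hf hlam hq he, Complex.normSq_eq_norm_sq,
      show θ ^ 2 * ‖muK L Δ lam2 f e' k‖ ^ 2 = (θ * ‖muK L Δ lam2 f e' k‖) ^ 2 by ring, Real.sqrt_sq (by positivity)]
  have hm2 : Real.sqrt ((m2 3 (shx q) e).eval X) = θ * ‖muK L Δ lam2 f e' (k + K1 L)‖ := by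
    rw [show shx q = (q.1 + 1, q.2) from rfl, eval_m2 L Δ lam2 f (by omega) hΔ0 hΔ1 hf hlam hq' he, toTor_shift,
      Complex.normSq_eq_norm_sq, show θ ^ 2 * ‖muK L Δ lam2 f (B1.toTor L e) (B1.toTor L q + K1 L)‖ ^ 2
        = (θ * ‖muK L Δ lam2 f e' (k + K1 L)‖) ^ 2 by ring, Real.sqrt_sq (by positivity)]
  have hp1 : (p1 3 q e).eval X = θ * P1 := by
    rw [eval_p1 L Δ lam2 f (by omega) hΔ0 hΔ1 hf hlam hq he, Real.sqrt_sq hθpos.le]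
  have hp2 : (p1 3 (shx q) e).eval X = θ * P2 := by
    rw [show shx q = (q.1 + 1, q.2) from rfl, eval_p1 L Δ lam2 f (by omega) hΔ0 hΔ1 hf hlam hq' he, toTor_shift,
      Real.sqrt_sq hθpos.le]
  have hdev : (dev12 3 q e).eval X = θ ^ 2 * (‖muK L Δ lam2 f e' k‖ * P2 + ‖muK L Δ lam2 f e' (k + K1 L)‖ * P1 + P1 * P2) := by
    have : (dev12 3 q e).eval X = Real.sqrt ((m2 3 q e).eval X) * (p1 3 (shx q) e).eval X
        + Real.sqrt ((m2 3 (shx q) e).eval X) * (p1 3 q e).eval X + (p1 3 q e).eval X * (p1 3 (shx q) e).eval X := by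
      simp only [dev12, rsum, RExpr.eval]; ring
    rw [this, hm1, hm2, hp1, hp2]; ring
  have hr := eval_r12 L Δ lam2 f (by omega) hΔ0 hΔ1 hf hlam hq hq' he
  have hθ2 : 0 ≤ θ ^ 2 := by positivity
  obtain ⟨hlo, hhi⟩ := abs_le.1 hbct
  have hA := mul_le_mul_of_nonneg_left hlo hθ2
  have hB := mul_le_mul_of_nonneg_left hhi hθ2
  constructor
  · show (r12 3 q e).eval X - (dev12 3 q e).eval X ≤ θ ^ 2 * _
    rw [hdev, hr]; linarith
  · show θ ^ 2 * _ ≤ (r12 3 q e).eval X + (dev12 3 q e).eval X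
    rw [hdev, hr]; linarith

/-! ## The pair block -/

/-- pair-block points: `q`, `q + x̂` are grid points of `M = 3` (re-export of `blockP_two_grid`). -/
theorem blockP_grid {q : ℤ × ℤ} (hq : q ∈ blockP 2) : q ∈ gridPts 3 ∧ (q.1 + 1, q.2) ∈ gridPts 3 := blockP_two_grid q hq

/-- ★ per block pair: `pairLo.eval X ≤ t²·Σ_e bcSummand(e, k) ≤ pairHi.eval X` (`k = toTor q`, `q ∈ blockP 2`). -/
theorem pair_bounds (hL : 7 ≤ L) (hΔ0 : 0 ≤ Δ) (hΔ1 : Δ < 1) (hf : IsGroundTwoMagnon L Δ lam2 f) (hlam : 0 < lam2)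
    {q : ℤ × ℤ} (hq : q ∈ blockP 2) :
    (pairLo 3 q).eval (xTrue L Δ lam2 f (Δ * f (K1 L)))
        ≤ ((2 * Real.pi / L) ^ 2) ^ 2 * ((nnList L).map (fun e => bcSummand L f e (B1.toTor L q))).sum ∧
    ((2 * Real.pi / L) ^ 2) ^ 2 * ((nnList L).map (fun e => bcSummand L f e (B1.toTor L q))).sum
        ≤ (pairHi 3 q).eval (xTrue L Δ lam2 f (Δ * f (K1 L))) := by
  set X := xTrue L Δ lam2 f (Δ * f (K1 L)) with hXdef
  set t : ℝ := (2 * Real.pi / L) ^ 2 with ht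
  set k := B1.toTor L q with hk
  obtain ⟨hq3, hq3'⟩ := blockP_grid hq
  have hF : (Fh 3 q).eval X = t * F2 L f k := eval_Fh L Δ lam2 f (by omega) hΔ0 hΔ1 hf hlam hq3
  have hF' : (Fh 3 (shx q)).eval X = t * F2 L f (k + K1 L) := by
    rw [show shx q = (q.1 + 1, q.2) from rfl, hXdef, eval_Fh L Δ lam2 f (by omega) hΔ0 hΔ1 hf hlam hq3', toTor_shift]
  have hker : ∀ e ∈ E4, (kerLo 3 q e).eval X ≤ t * Complex.normSq (phiHat L f (B1.toTor L e) k) ∧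
      t * Complex.normSq (phiHat L f (B1.toTor L e) k) ≤ (kerHi 3 q e).eval X :=
    fun e he => ker_bounds L Δ lam2 f hL hΔ0 hΔ1 hf hlam hq3 he
  have hcr : ∀ e ∈ E4, (r12 3 q e).eval X - (dev12 3 q e).eval X
        ≤ t * ((starRingEnd ℂ) (phiHat L f (B1.toTor L e) k) * phiHat L f (B1.toTor L e) (k + K1 L)).re ∧
      t * ((starRingEnd ℂ) (phiHat L f (B1.toTor L e) k) * phiHat L f (B1.toTor L e) (k + K1 L)).re
        ≤ (r12 3 q e).eval X + (dev12 3 q e).eval X :=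
    fun e he => cross_bounds L Δ lam2 f hL hΔ0 hΔ1 hf hlam hq3 hq3' he
  have htrue : t ^ 2 * ((nnList L).map (fun e => bcSummand L f e k)).sum
      = (E4.map fun e => t * ((starRingEnd ℂ) (phiHat L f (B1.toTor L e) k) * phiHat L f (B1.toTor L e) (k + K1 L)).re
          * (t * F2 L f k + t * F2 L f (k + K1 L))
        + t * Complex.normSq (phiHat L f (B1.toTor L e) k) * (t * F2 L f (k + K1 L))).sum := by
    rw [nnList_eq_map]
    unfold bcSummand
    simp only [E4, List.map_cons, List.map_nil, List.sum_cons, List.sum_nil]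
    ring
  constructor
  · have e1 : (pairLo 3 q).eval X = (E4.map fun e =>
        min (((r12 3 q e).eval X - (dev12 3 q e).eval X) * ((Fh 3 q).eval X + (Fh 3 (shx q)).eval X))
            (((r12 3 q e).eval X + (dev12 3 q e).eval X) * ((Fh 3 q).eval X + (Fh 3 (shx q)).eval X))
        + min ((kerLo 3 q e).eval X * (Fh 3 (shx q)).eval X) ((kerHi 3 q e).eval X * (Fh 3 (shx q)).eval X)).sum := by
      simp only [pairLo, mulLo, eval_rsum, List.map_map, Function.comp_def, RExpr.eval]
    rw [e1, htrue]
    refine List.sum_le_sum fun e he => ?_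
    rw [hF, hF']
    exact add_le_add (min_mul_le (hcr e he).1 (hcr e he).2 _) (min_mul_le (hker e he).1 (hker e he).2 _)
  · have e1 : (pairHi 3 q).eval X = (E4.map fun e =>
        max (((r12 3 q e).eval X - (dev12 3 q e).eval X) * ((Fh 3 q).eval X + (Fh 3 (shx q)).eval X))
            (((r12 3 q e).eval X + (dev12 3 q e).eval X) * ((Fh 3 q).eval X + (Fh 3 (shx q)).eval X))
        + max ((kerLo 3 q e).eval X * (Fh 3 (shx q)).eval X) ((kerHi 3 q e).eval X * (Fh 3 (shx q)).eval X)).sum := by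
      simp only [pairHi, mulHi, eval_rsum, List.map_map, Function.comp_def, RExpr.eval]
    rw [e1, htrue]
    refine List.sum_le_sum fun e he => ?_
    rw [hF, hF']
    exact add_le_add (mul_le_max (hcr e he).1 (hcr e he).2 _) (mul_le_max (hker e he).1 (hker e he).2 _)

/-! ## The two special pairs -/

/-- ★ `gam1 ↦ γ` (un-hatted; `γ = λ₂F₂(0)/4 + a(a + η)`). -/
theorem eval_gam1 (hL : 5 ≤ L) (hΔ0 : 0 ≤ Δ) (hΔ1 : Δ < 1) (hf : IsGroundTwoMagnon L Δ lam2 f) (hlam : 0 < lam2) :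
    gam1.eval (xTrue L Δ lam2 f (Δ * f (K1 L))) = gamPar L Δ lam2 f := by
  set X := xTrue L Δ lam2 f (Δ * f (K1 L)) with hXdef
  obtain ⟨_, _, d3, _, _, _, _⟩ := ManifoldA.manifold_dictionary L hL hΔ0 hΔ1 hf
  have hF0 : F0h.eval X = (2 * Real.pi / L) ^ 2 * F2 L f 0 := eval_F0h L Δ lam2 f hL hΔ0 hΔ1 hf hlam
  have he := eval_eta L Δ lam2 f (by omega) (Δ * f (K1 L))
  have hX2 : X 2 = lam2 / (2 * Real.pi / L) ^ 2 := by rw [hXdef, xTrue_lt16 L Δ lam2 f _ (by norm_num)]; rfl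
  have hX3 : X 3 = Δ * f (K1 L) := by rw [hXdef, xTrue_lt16 L Δ lam2 f _ (by norm_num)]; rfl
  have h0 := (OuterMaj.f2ClosedPlusTail_holds L hL hΔ0 lam2 f hf hlam).1
  have hLpos : (0 : ℝ) < L := by exact_mod_cast (show 0 < L by omega)
  have hθ2 : (2 * Real.pi / (L : ℝ)) ^ 2 ≠ 0 := by positivity
  have e : gam1.eval X = (X 2 * F0h.eval X + 4 * X 3 * (X 3 + eta.eval X)) * (1 / 4) := by
    simp only [gam1, RExpr.eval, cst, vNu, vA]; push_cast; ring
  rw [e, hF0, he, hX2, hX3]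
  unfold gamPar
  rw [h0, d3]
  field_simp

/-- ★ special-pair closed cross term: `r0 k e ↦ t·γ·Re μ_e(toTor k)` (`k = (±1, 0)`). -/
theorem eval_r0 (hL : 5 ≤ L) (hΔ0 : 0 ≤ Δ) (hΔ1 : Δ < 1) (hf : IsGroundTwoMagnon L Δ lam2 f) (hlam : 0 < lam2)
    {p e : ℤ × ℤ} (hp : p ∈ gridPts 3) (he : e ∈ E4) :
    (r0 3 p e).eval (xTrue L Δ lam2 f (Δ * f (K1 L)))
      = (2 * Real.pi / L) ^ 2 * (gamPar L Δ lam2 f * (muK L Δ lam2 f (B1.toTor L e) (B1.toTor L p)).re) := by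
  set X := xTrue L Δ lam2 f (Δ * f (K1 L)) with hXdef
  set t : ℝ := (2 * Real.pi / L) ^ 2 with ht
  obtain ⟨_, _, hb⟩ := eval_closed L Δ lam2 f hL hΔ0 hΔ1 hf hlam hp
  have hqq := eval_qq L Δ lam2 f hL hΔ0 hΔ1 hf
  have hg := eval_gam1 L Δ lam2 f hL hΔ0 hΔ1 hf hlam
  have hX0 : X 0 = t := xTrue_zero L Δ lam2 f _
  have hw := one_sub_phase_re L Δ lam2 f (Δ * f (K1 L)) hp he
  have hre : (muK L Δ lam2 f (B1.toTor L e) (B1.toTor L p)).re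
      = -(1 - (phase L (B1.toTor L p) (B1.toTor L e)).re) * betaK L Δ lam2 f (B1.toTor L p)
        + qPar L Δ f / 2 * (1 + (phase L (B1.toTor L p) (B1.toTor L e)).re) := by
    unfold muK zPh
    simp only [Complex.add_re, Complex.neg_re, Complex.mul_re, Complex.sub_re, Complex.one_re,
      Complex.one_im, Complex.conj_re, Complex.conj_im, Complex.ofReal_re, Complex.ofReal_im, Complex.add_im]
    ring
  have e1 : (r0 3 p e).eval X = gam1.eval X * (-(X 0 * (wOf 3 (qdot p e)).eval X * (bh 3 p).eval X)
      + 1 / 2 * qq.eval X * X 0 * (2 - X 0 * (wOf 3 (qdot p e)).eval X)) := by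
    simp only [r0, RExpr.eval, cst, vT]; push_cast; ring
  rw [e1, hg, hb, hqq, hX0, hre]
  set w := (wOf 3 (qdot p e)).eval X
  have h1 : (phase L (B1.toTor L p) (B1.toTor L e)).re = 1 - t * w := by rw [← hw]; ring
  rw [h1]; ring

/-- ★ special-pair deviation: `|t·γ·Re φ̂_e(k) − r0| ≤ dev0` (`k = toTor p ≠ 0`). -/
theorem special_bounds (hL : 7 ≤ L) (hΔ0 : 0 ≤ Δ) (hΔ1 : Δ < 1) (hf : IsGroundTwoMagnon L Δ lam2 f) (hlam : 0 < lam2)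
    {p e : ℤ × ℤ} (hp : p ∈ gridPts 3) (he : e ∈ E4) :
    let X := xTrue L Δ lam2 f (Δ * f (K1 L))
    let x := (2 * Real.pi / L) ^ 2 * (gamPar L Δ lam2 f * (phiHat L f (B1.toTor L e) (B1.toTor L p)).re)
    (r0 3 p e).eval X - (dev0 3 p e).eval X ≤ x ∧ x ≤ (r0 3 p e).eval X + (dev0 3 p e).eval X := by
  intro X x
  set θ : ℝ := 2 * Real.pi / L with hθ
  set k := B1.toTor L p with hk
  set e' := B1.toTor L e with he'
  have hLpos : (0 : ℝ) < L := by exact_mod_cast (show 0 < L by omega)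
  have hθpos : 0 < θ := by positivity
  have hk0 : k ≠ 0 := by
    show B1.toTor L p ≠ 0
    have := B1.intCast_ne_zero_of_mem_zWindow L 3 (by omega) p (gridPts_three_window p hp)
    simpa [B1.toTor] using this
  set P : ℝ := ‖(1 : ℂ) - zPh L k e'‖ / 2 * |tfun L Δ f k| + tauBar L Δ lam2 f / 2 with hP
  have hn : ‖phiHat L f e' k - muK L Δ lam2 f e' k‖ ≤ P :=
    OuterMaj.phiHatNearClosed_holds L (by omega) hΔ0 lam2 f hf hlam e' (toTor_mem_nnList L he) k hk0
  have hre : |(phiHat L f e' k).re - (muK L Δ lam2 f e' k).re| ≤ P := by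
    rw [← Complex.sub_re]
    exact (Complex.abs_re_le_norm _).trans hn
  have hp1 : (p1 3 p e).eval X = θ * P := by
    rw [eval_p1 L Δ lam2 f (by omega) hΔ0 hΔ1 hf hlam hp he, Real.sqrt_sq hθpos.le]
  have hg := eval_gam1 L Δ lam2 f (by omega) hΔ0 hΔ1 hf hlam
  have hX0 : X 0 = θ ^ 2 := xTrue_zero L Δ lam2 f _
  have hdev : (dev0 3 p e).eval X = θ ^ 2 * (|gamPar L Δ lam2 f| * P) := by
    have : (dev0 3 p e).eval X = Real.sqrt (X 0) * |gam1.eval X| * (p1 3 p e).eval X := by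
      simp only [dev0, RExpr.eval, vT]
    rw [this, hX0, Real.sqrt_sq hθpos.le, hg, hp1]; ring
  have hr := eval_r0 L Δ lam2 f (by omega) hΔ0 hΔ1 hf hlam hp he
  have key : |θ ^ 2 * (gamPar L Δ lam2 f * (phiHat L f e' k).re) - θ ^ 2 * (gamPar L Δ lam2 f * (muK L Δ lam2 f e' k).re)|
      ≤ θ ^ 2 * (|gamPar L Δ lam2 f| * P) := by
    rw [← mul_sub, ← mul_sub, abs_mul, abs_mul, abs_of_nonneg (by positivity : (0:ℝ) ≤ θ ^ 2)]
    exact mul_le_mul_of_nonneg_left (mul_le_mul_of_nonneg_left hre (abs_nonneg _)) (by positivity)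
  obtain ⟨hlo, hhi⟩ := abs_le.1 key
  constructor
  · show (r0 3 p e).eval X - (dev0 3 p e).eval X ≤ θ ^ 2 * _
    rw [hdev, hr]; linarith
  · show θ ^ 2 * _ ≤ (r0 3 p e).eval X + (dev0 3 p e).eval X
    rw [hdev, hr]; linarith

end Summit.HubbardSuperconductivity.HubbardSuperconductivity.Theorems.AnisotropyChord.Transfer.Fibre3.L2.N1
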